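import Literature.Analysis.FluidPDE.TypeIAncientMildClassical
import Literature.Analysis.FluidPDE.ClassicalSolutionGlue
import Literature.Analysis.FluidPDE.SpaceTimeCalculus
import HarnessLib

/-!
# One pressure on the whole ancient slab for a Type-I ancient mild field
# (route `AdaptedFrequency`, item `TangentFlowTransfer`, stmt-NavierStokesRegularity-10494)

Helper file (all results proved). The tree's
`Literature.Analysis.FluidPDE.IsTypeIAncientMild.exists_isClassicalNSSolutionOn_Ioo` provides, on
every window `(t₀, 0)`, a smooth pressure making a Type-I ancient mild field `u` a classical
solution of the unforced Navier–Stokes system (`ν = 1`); the pressures of two windows differ by a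
function of time only (`IsClassicalNSSolutionOn.pressure_sub_apply_zero_eq_of_eventuallyEq`). The
conclusion of `TangentFlowTransfer` wants **one** pressure on all of `(−∞, 0)`: normalising each
window pressure by its value at the spatial origin, `q(t, x) = pₙ(t, x) − pₙ(t, 0)` with any window
`(−n−1, 0) ∋ t`, is independent of `n`, jointly smooth, and has the same gradient, so `(u, q)` is a
classical solution on `Iio 0` (`exists_isClassicalNSSolutionOn_Iio_of_isTypeIAncientMild`).

References: G. Koch, N. Nadirashvili, G. Seregin, V. Šverák, Acta Math. 203 (2009), §4 (the
pressure of a mild solution is determined up to a function of time).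
-/

noncomputable section

open MeasureTheory Set Function Filter TopologicalSpace Metric
open scoped Topology

namespace Summit.NavierStokesRegularity.NavierStokesRegularity.Theorems

open Literature.Analysis Literature.Analysis.FluidPDE

variable {E : Type*} [NormedAddCommGroup E] [InnerProductSpace ℝ E] [FiniteDimensional ℝ E]
  [MeasurableSpace E] [BorelSpace E]

/-- **A Type-I ancient mild field is a classical solution on the whole slab `(−∞, 0)` for one
smooth pressure** (normalise the window pressures at the spatial origin; module docstring).
[cite: KochNadirashviliSereginSverak2009, §4 p. 8 (arXiv:0709.3599)] -/
theorem exists_isClassicalNSSolutionOn_Iio_of_isTypeIAncientMild {C : ℝ} {u : ℝ → E → E}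
    (hu : IsTypeIAncientMild C u) :
    ∃ q : ℝ → E → ℝ, IsClassicalNSSolutionOn (Iio 0) 1 0 u q := by
  -- window pressures on `(-(n+1), 0)`
  have hwin : ∀ n : ℕ, ∃ p : ℝ → E → ℝ, IsClassicalNSSolutionOn (Ioo (-((n : ℝ) + 1)) 0) 1 0 u p :=
    fun n => hu.exists_isClassicalNSSolutionOn_Ioo (by
      have : (0 : ℝ) ≤ n := Nat.cast_nonneg n
      linarith)
  choose p hp using hwin
  -- the window index of a time `t < 0`
  set idx : ℝ → ℕ := fun t => Nat.ceil (-t) with hidx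
  have hmem : ∀ t < 0, t ∈ Ioo (-((idx t : ℝ) + 1)) 0 := fun t ht => by
    refine ⟨?_, ht⟩
    have h1 : -t ≤ (Nat.ceil (-t) : ℝ) := Nat.le_ceil (-t)
    simp only [hidx]
    linarith
  -- the normalised pressure
  set q : ℝ → E → ℝ := fun t x => p (idx t) t x - p (idx t) t 0 with hq
  -- on a window containing `t`, `q` is the normalised window pressure of ANY admissible index
  have hloc : ∀ n : ℕ, ∀ t ∈ Ioo (-((n : ℝ) + 1)) 0, ∀ x, q t x = p n t x - p n t 0 := by
    intro n t ht x
    have ht0 : t < 0 := ht.2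
    have h1 : Ioo (-((idx t : ℝ) + 1)) 0 ∈ 𝓝 t := isOpen_Ioo.mem_nhds (hmem t ht0)
    have h2 : Ioo (-((n : ℝ) + 1)) 0 ∈ 𝓝 t := isOpen_Ioo.mem_nhds ht
    exact (hp (idx t)).pressure_sub_apply_zero_eq_of_eventuallyEq (hp n) h1 h2
      (Eventually.of_forall fun _ => rfl) x
  refine ⟨q, ?_, ?_, ?_, ?_⟩
  · -- smooth velocity
    exact hu.contDiffOn
  · -- smooth pressure: locally the normalised window pressure
    refine contDiffOn_of_locally_contDiffOn ?_
    rintro ⟨t, x⟩ ⟨ht, -⟩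
    have ht0 : t < 0 := ht
    set n := idx t
    refine ⟨Ioo (-((n : ℝ) + 1)) 0 ×ˢ univ, isOpen_Ioo.prod isOpen_univ,
      ⟨hmem t ht0, mem_univ _⟩, ?_⟩
    have hsm : IsSmoothSpaceTimeOn (Ioo (-((n : ℝ) + 1)) 0) (fun s y => p n s y - p n s 0) :=
      (hp n).smooth_pressure.sub_apply_zero
    have hsub : Iio (0 : ℝ) ×ˢ (univ : Set E) ∩ Ioo (-((n : ℝ) + 1)) 0 ×ˢ univ =
        Ioo (-((n : ℝ) + 1)) 0 ×ˢ univ := by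
      ext ⟨s, y⟩
      simp only [mem_inter_iff, mem_prod, mem_Iio, mem_Ioo, mem_univ, and_true]
      constructor
      · rintro ⟨-, h⟩; exact h
      · rintro h; exact ⟨h.2, h⟩
    rw [hsub]
    refine hsm.congr ?_
    rintro ⟨s, y⟩ ⟨hs, -⟩
    exact hloc n s hs y
  · -- momentum equation
    intro t ht x
    have ht0 : t < 0 := ht
    set n := idx t
    have htn : t ∈ Ioo (-((n : ℝ) + 1)) 0 := hmem t ht0
    have hm := (hp n).momentum t htn x
    -- time derivatives: both time sets are open neighbourhoods of `t`
    have hd : timeDerivWithin (Iio 0) u t x = timeDerivWithin (Ioo (-((n : ℝ) + 1)) 0) u t x := by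
      rw [timeDerivWithin_eq_deriv isOpen_Iio ht0 u x, timeDerivWithin_eq_deriv isOpen_Ioo htn u x]
    -- pressure gradients
    have hg : gradient (q t) x = gradient (p n t) x := by
      have e : q t = fun y => p n t y - p n t 0 := funext fun y => hloc n t htn y
      rw [e, gradient_sub_const]
    rw [hd, hg]
    exact hm
  · -- divergence free
    intro t ht
    exact hu.isDivFree ht

end Summit.NavierStokesRegularity.NavierStokesRegularity.Theorems

end
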